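import Mathlib.AlgebraicGeometry.Fiber
import Summits.ResolutionOfSingularities.ResolutionOfSingularities.Theorems.FrobeniusLadderFRationalResolutionIntrinsicRecipeGlobal
import Summits.ResolutionOfSingularities.ResolutionOfSingularities.Theorems.FrobeniusLadderFRationalResolutionMaximalIdealTower
import Summits.ResolutionOfSingularities.ResolutionOfSingularities.Theorems.FrobeniusLadderFInjectiveMacaulayficationBadPointsClosed
import Summits.ResolutionOfSingularities.ResolutionOfSingularities.Theorems.EquisingularLiftEquisingularLiftNatRegularOfSpecialFibre
import HarnessLib

/-!
# Crux `FrobeniusLadder.FRationalResolution` (stmt-ResolutionOfSingularities-15317), line `redirect`,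
# stub `stub_diagonalizableQuotientResolution` — HYGIENE: a FINITE singular locus of `Bl_J(Spec R)` over the
# closed point is closed and consists of closed points

The capstones of the (S1)/naive intrinsic recipe (`…IntrinsicRecipe.hloc_of_characteristic_then_singularPoints`,
p839630; `…MaximalIdealTower.hloc_of_maximalIdealPow_then_singularPoints`, p839495;
`…IntrinsicRecipeGlobal.hasResolution_of_characteristic_then_singularPoints`, p839830) carry two hygiene hypotheses on
`X₁ = Bl_{J₁}(Spec Ê)`: the singular locus `Sing X₁ = X₁ ∖ Reg X₁` is CLOSED (`hZc`) and consists of CLOSED POINTS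
(`hpt`). What the fan computation of a class actually delivers is that `Sing X₁` is FINITE. This file shows that
finiteness suffices:

* `stableUnderSpecialization_compl_regularLocus` — the singular locus of ANY scheme is stable under specialisation
  (regularity generises: `𝒪_{X,x'}` is a localisation of `𝒪_{X,x}` for `x' ⤳ x`, Stacks 01J7 + Serre/Matsumura 19.3;
  tree `isRegularLocalRing_stalk_of_specializes`);
* `isClosed_of_finite_of_stableUnderSpecialization` — a finite specialisation-stable set is closed;
* `isClosed_singleton_of_subset_fiber` — for `f : X → Y` locally of finite type and a CLOSED point `y`, every point of
  a finite specialisation-stable `Z ⊆ f⁻¹(y)` is a closed point of `X` (the fibre `f⁻¹(y)` is a Jacobson space, Mathlib;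
  a point with finite closure in a Jacobson space is closed, tree `…BadPointsClosed`; `f⁻¹(y) ↪ X` is a closed embedding);
* ★ `isClosed_and_isClosed_singleton_of_finite` — for `R` Noetherian, `𝔪` maximal and `J` any ideal: if `Sing Bl_J(Spec R)`
  is finite and lies over `V(𝔪)` then it is closed and all its points are closed;
* ★★ the capstones with `(hZc, hpt)` replaced by `hfin : (Sing X₁).Finite`:
  `exists_characteristic_ideal_isRegular_of_finite_singularPoints`, `hloc_of_characteristic_then_finite_singularPoints`,
  `hloc_of_maximalIdealPow_then_finite_singularPoints` (here `hZ𝔪` is discharged as well, by p839565),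
  `hasResolution_of_characteristic_then_finite_singularPoints`.

Honest label: hygiene/plumbing toward ONE leaf stub (no stub, crux or summit closed). No definitions, no named facts,
no sorry. [cite: StacksProject, Tag 01J7; Tag 02J8; Tag 080B] [cite: Matsumura1987, Thm. 19.3]
-/

noncomputable section

-- single-problem summit: the doubled namespace component is forced
set_option linter.dupNamespace false

open CategoryTheory AlgebraicGeometry TopologicalSpace IsLocalRing Topology TensorProduct
open Literature.AlgebraicGeometry.Resolution
open Summit.ResolutionOfSingularities.ResolutionOfSingularities.Theorems.FRationalResolution

namespace Summit.ResolutionOfSingularities.ResolutionOfSingularities.Theorems.FRationalResolution.SingularPointsFinite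

universe u

/-! ## §1 Topology -/

/-- **A finite set stable under specialisation is closed**: it is the finite union of the closures of its
points. [folklore] -/
theorem isClosed_of_finite_of_stableUnderSpecialization {X : Type*} [TopologicalSpace X] {Z : Set X}
    (hfin : Z.Finite) (hstab : StableUnderSpecialization Z) : IsClosed Z := by
  rw [← hstab.Union_eq]
  exact hfin.isClosed_biUnion fun _ _ => isClosed_closure

/-- **Points of a finite specialisation-stable set inside a closed fibre are closed points.** `f : X → Y`
locally of finite type, `y ∈ Y` a closed point, `Z ⊆ f⁻¹(y)` finite and stable under specialisation in `X`:
every `z ∈ Z` is a closed point of `X`. The fibre is a Jacobson space (Mathlib), in which a point with finite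
closure is closed (`…BadPointsClosed.isClosed_singleton_of_stableUnderSpecialization_finite`), and the fibre
embeds into `X` as a closed subspace. [cite: StacksProject, Tag 02J8] [folklore] -/
theorem isClosed_singleton_of_subset_fiber {X Y : Scheme.{u}} (f : X ⟶ Y) [LocallyOfFiniteType f] (y : Y)
    (hy : IsClosed ({y} : Set Y)) {Z : Set X} (hZy : Z ⊆ f ⁻¹' {y}) (hfin : Z.Finite)
    (hstab : StableUnderSpecialization Z) {z : X} (hz : z ∈ Z) : IsClosed ({z} : Set X) := by
  have hrange : Set.range (f.fiberι y) = f ⁻¹' {y} := f.range_fiberι y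
  have hemb : IsClosedEmbedding (f.fiberι y) :=
    ⟨(f.fiberι y).isEmbedding, by rw [hrange]; exact hy.preimage f.continuous⟩
  -- pull `Z` back to the scheme-theoretic fibre
  set Z' : Set ↥(f.fiber y) := (f.fiberι y) ⁻¹' Z with hZ'
  have hfin' : Z'.Finite := hfin.preimage (Set.injOn_of_injective hemb.injective)
  have hstab' : StableUnderSpecialization Z' := fun a b hab ha => hstab (hab.map (f.fiberι y).continuous) ha
  obtain ⟨z', hz'⟩ : z ∈ Set.range (f.fiberι y) := by
    rw [hrange]
    exact hZy hz
  have hz'Z : z' ∈ Z' := by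
    change (f.fiberι y) z' ∈ Z
    rw [hz']
    exact hz
  have hcl : IsClosed ({z'} : Set ↥(f.fiber y)) :=
    FInjectiveMacaulayfication.BadPointsClosed.isClosed_singleton_of_stableUnderSpecialization_finite hfin' hstab' hz'Z
  have himg := hemb.isClosedMap _ hcl
  rwa [Set.image_singleton, hz'] at himg

/-! ## §2 The singular locus is stable under specialisation -/

/-- **The singular locus `X ∖ Reg X` of any scheme is stable under specialisation**: if `x ⤳ x'` and `𝒪_{X,x'}`
were regular then so would be its localisation `𝒪_{X,x}` (Stacks 01J7, Matsumura 19.3; tree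
`isRegularLocalRing_stalk_of_specializes`). [cite: StacksProject, Tag 01J7] [cite: Matsumura1987, Thm. 19.3] -/
theorem stableUnderSpecialization_compl_regularLocus (X : Scheme.{u}) :
    StableUnderSpecialization (Scheme.regularLocus X)ᶜ := by
  intro x x' hxx' hx hx'
  exact hx (Cruxes.EquisingularLiftNat.Sections.isRegularLocalRing_stalk_of_specializes hxx' hx')

/-- The singular locus of a scheme is closed as soon as it is finite. [folklore] -/
theorem isClosed_compl_regularLocus_of_finite (X : Scheme.{u}) (hfin : (Scheme.regularLocus X)ᶜ.Finite) :
    IsClosed (Scheme.regularLocus X)ᶜ :=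
  isClosed_of_finite_of_stableUnderSpecialization hfin (stableUnderSpecialization_compl_regularLocus X)

/-! ## §3 Finite singular loci of blow-ups over the closed point -/

/-- ★ **A finite singular locus of `Bl_J(Spec R)` lying over a closed point is closed and consists of closed
points.** `R` Noetherian, `𝔪` maximal, `J` any ideal; if `Sing Bl_J(Spec R)` is finite and every singular point
lies over `V(𝔪)`, then `Sing Bl_J(Spec R)` is closed and each of its points is closed (the closed fibre of the
projective morphism `Bl_J(Spec R) → Spec R` is a Jacobson space). [cite: StacksProject, Tag 02J8; Tag 01J7]
[folklore] -/
theorem isClosed_and_isClosed_singleton_of_finite {R : Type} [CommRing R] [IsNoetherianRing R] (𝔪 J : Ideal R)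
    [h𝔪 : 𝔪.IsMaximal] (hfin : (Scheme.regularLocus (affineBlowup J))ᶜ.Finite)
    (hZ𝔪 : ∀ z ∈ (Scheme.regularLocus (affineBlowup J))ᶜ, 𝔪 ≤ (affineBlowup.π J z).asIdeal) :
    IsClosed (Scheme.regularLocus (affineBlowup J))ᶜ ∧
      ∀ z ∈ (Scheme.regularLocus (affineBlowup J))ᶜ, IsClosed ({z} : Set ↥(affineBlowup J)) := by
  have hstab := stableUnderSpecialization_compl_regularLocus (affineBlowup J)
  refine ⟨isClosed_of_finite_of_stableUnderSpecialization hfin hstab, fun z hz => ?_⟩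
  -- the closed point `𝔪` of `Spec R`
  let s : ↥(Spec (.of R)) := (⟨𝔪, h𝔪.isPrime⟩ : PrimeSpectrum R)
  have hs : IsClosed ({s} : Set ↥(Spec (.of R))) := (PrimeSpectrum.isClosed_singleton_iff_isMaximal s).mpr h𝔪
  have hZs : (Scheme.regularLocus (affineBlowup J))ᶜ ⊆ (affineBlowup.π J) ⁻¹' {s} := by
    intro w hw
    have hle := hZ𝔪 w hw
    change affineBlowup.π J w = s
    exact PrimeSpectrum.ext (h𝔪.eq_of_le (affineBlowup.π J w).isPrime.ne_top hle).symm
  exact isClosed_singleton_of_subset_fiber (affineBlowup.π J) s hs hZs hfin hstab hz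

/-! ## §4 The capstones with a FINITE singular locus -/

/-- ★★ **THE POINT STEP, FINITE FORM.** As `…PointCentreBlowupRegular.exists_characteristic_ideal_isRegular_of_singularPoints`
(p839317) with `𝔪` maximal and the hypotheses «`Sing X₁` closed, of closed points» replaced by «`Sing X₁` finite».
[cite: StacksProject, Tag 080B; Tag 02J8] [folklore] -/
theorem exists_characteristic_ideal_isRegular_of_finite_singularPoints {R : Type} [CommRing R] [IsNoetherianRing R]
    (𝔪 J₁ : Ideal R) [𝔪.IsMaximal] {n : ℕ} (hn : 𝔪 ^ n ≤ J₁) (hJ₁top : J₁ ≠ ⊤)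
    (hJ₁ : ∀ θ : R ≃+* R, J₁.map (θ : R →+* R) ≤ J₁)
    (hfin : (Scheme.regularLocus (affineBlowup J₁))ᶜ.Finite)
    (hZ𝔪 : ∀ z ∈ (Scheme.regularLocus (affineBlowup J₁))ᶜ, 𝔪 ≤ (affineBlowup.π J₁ z).asIdeal)
    (hloc : ∀ z ∈ (Scheme.regularLocus (affineBlowup J₁))ᶜ,
      Scheme.IsRegular (affineBlowup (maximalIdeal ((affineBlowup J₁).presheaf.stalk z)))) :
    ∃ (J₂ : Ideal R) (c : ℕ), (∀ θ : R ≃+* R, J₂.map (θ : R →+* R) ≤ J₂) ∧ 𝔪 ^ c ≤ J₂ ∧ J₂ ≠ ⊤ ∧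
      Scheme.IsRegular (affineBlowup J₂) := by
  obtain ⟨hZc, hpt⟩ := isClosed_and_isClosed_singleton_of_finite 𝔪 J₁ hfin hZ𝔪
  exact PointCentreBlowupRegular.exists_characteristic_ideal_isRegular_of_singularPoints 𝔪 J₁ hn hJ₁top hJ₁ hZc hpt
    hZ𝔪 hloc

/-- ★★★ **A CHARACTERISTIC CENTRE, THEN FINITELY MANY SINGULAR POINTS, SETTLES THE TWISTED POINT.** As
`…IntrinsicRecipe.hloc_of_characteristic_then_singularPoints` (p839630) with «`Sing X₁` closed, of closed points» replaced by
«`Sing X₁` finite» (`X₁ = Bl_{J₁}(Spec Ê)`; the singular points lie over `V(𝔪̂)` by p839565).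
[cite: StacksProject, Tag 080B; Tag 0CDQ; Tag 09EB; Tag 02J8] [cite: Matsumura1987, Thm. 8.11; Thm. 8.14; Thm. 23.7] -/
theorem hloc_of_characteristic_then_finite_singularPoints (K : Type) [Field K] (X : Scheme.{0}) [IsIntegral X]
    (f : X ⟶ Spec (.of K)) [LocallyOfFiniteType f]
    {B : Type} [CommRing B] [IsDomain B] [Algebra K B] [Algebra.FiniteType K B]
    (ι : Spec (.of B) ⟶ X) [IsOpenImmersion ι] (hι : ι ≫ f = Spec.map (CommRingCat.ofHom (algebraMap K B)))
    (𝔭 : Ideal B) [h𝔭 : 𝔭.IsMaximal] (h𝔭0 : 𝔭 ≠ ⊥)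
    (hsing : ι ⟨𝔭, h𝔭.isPrime⟩ ∉ Scheme.regularLocus X)
    (hregB : ∀ P : Spec (.of B), P.asIdeal ≠ 𝔭 → P ∈ Scheme.regularLocus (Spec (.of B)))
    (K' : Type) [Field K'] [Algebra K K'] [FiniteDimensional K K'] [IsGalois K K']
    (𝔔' : Ideal (B ⊗[K] K')) [h𝔔' : 𝔔'.IsMaximal] (h𝔔'𝔭 : 𝔔'.comap (algebraMap B (B ⊗[K] K')) = 𝔭)
    (J₁ : Ideal (AdicCompletion (maximalIdeal (Localization.AtPrime 𝔔')) (Localization.AtPrime 𝔔'))) {n : ℕ}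
    (hn : 𝔔'.map (algebraMap (B ⊗[K] K')
      (AdicCompletion (maximalIdeal (Localization.AtPrime 𝔔')) (Localization.AtPrime 𝔔'))) ^ n ≤ J₁)
    (hJ₁top : J₁ ≠ ⊤)
    (hchar : ∀ θ : AdicCompletion (maximalIdeal (Localization.AtPrime 𝔔')) (Localization.AtPrime 𝔔') ≃+*
        AdicCompletion (maximalIdeal (Localization.AtPrime 𝔔')) (Localization.AtPrime 𝔔'), J₁.map (θ : _ →+* _) ≤ J₁)
    (hfin : (Scheme.regularLocus (affineBlowup J₁))ᶜ.Finite)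
    (hloc : ∀ z ∈ (Scheme.regularLocus (affineBlowup J₁))ᶜ,
      Scheme.IsRegular (affineBlowup (maximalIdeal ((affineBlowup J₁).presheaf.stalk z)))) :
    ∃ (V : X.Opens), ι ⟨𝔭, h𝔭.isPrime⟩ ∈ V ∧
      (∀ t : X, t ∉ Scheme.regularLocus X → t ∈ V → t = ι ⟨𝔭, h𝔭.isPrime⟩) ∧
      ∃ (Y : Scheme.{0}) (ρ : Y ⟶ V), IsProper ρ ∧ Scheme.IsRegular Y ∧
        IsIso (ρ ∣_ (V.ι ⁻¹ᵁ ⟨Scheme.regularLocus X, isOpen_regularLocus_of_locallyOfFiniteType_field f⟩)) ∧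
        Dense ((ρ ⁻¹ᵁ (V.ι ⁻¹ᵁ ⟨Scheme.regularLocus X,
          isOpen_regularLocus_of_locallyOfFiniteType_field f⟩) : Y.Opens) : Set Y) := by
  haveI : IsNoetherianRing B := Algebra.FiniteType.isNoetherianRing K B
  haveI : Algebra.FiniteType B (B ⊗[K] K') := inferInstance
  haveI : IsNoetherianRing (B ⊗[K] K') := Algebra.FiniteType.isNoetherianRing B (B ⊗[K] K')
  haveI : IsNoetherianRing (Localization.AtPrime 𝔔') :=
    IsLocalization.isNoetherianRing 𝔔'.primeCompl (Localization.AtPrime 𝔔') inferInstance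
  set Ê := AdicCompletion (maximalIdeal (Localization.AtPrime 𝔔')) (Localization.AtPrime 𝔔') with hÊ
  haveI : IsNoetherianRing Ê := isNoetherianRing_adicCompletion_maximalIdeal _
  have hfac : algebraMap (B ⊗[K] K') Ê =
      (algebraMap (Localization.AtPrime 𝔔') Ê).comp (algebraMap (B ⊗[K] K') (Localization.AtPrime 𝔔')) :=
    RingHom.ext fun _ => rfl
  have hmapQ : 𝔔'.map (algebraMap (B ⊗[K] K') Ê) = maximalIdeal Ê := by
    rw [hfac, ← Ideal.map_map, Localization.AtPrime.map_eq_maximalIdeal, ← AdicCompletion.maximalIdeal_eq_map]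
  set 𝔪 := 𝔔'.map (algebraMap (B ⊗[K] K') Ê) with h𝔪
  haveI h𝔪max : 𝔪.IsMaximal := by
    rw [hmapQ]
    infer_instance
  have hJ₁𝔪 : J₁ ≤ 𝔪 := by
    rw [hmapQ]
    exact IsLocalRing.le_maximalIdeal hJ₁top
  -- singular points of `Bl_{J₁}` lie over `V(𝔪̂)` (p839565), so the finite singular locus is closed, of closed points
  have hZ𝔪 : ∀ z ∈ (Scheme.regularLocus (affineBlowup J₁))ᶜ, 𝔪 ≤ (affineBlowup.π J₁ z).asIdeal :=
    SingularPointsOverVertex.hZ𝔪_of_galois K 𝔭 hregB K' 𝔔' J₁ hn hJ₁𝔪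
  obtain ⟨hZc, hpt⟩ := isClosed_and_isClosed_singleton_of_finite 𝔪 J₁ hfin hZ𝔪
  exact IntrinsicRecipe.hloc_of_characteristic_then_singularPoints K X f ι hι 𝔭 h𝔭0 hsing hregB K' 𝔔' h𝔔'𝔭 J₁ hn
    hJ₁top hchar hZc hpt hloc

/-- ★★ **TWO NAIVE STEPS, FINITE FORM.** As `…MaximalIdealTower.hloc_of_maximalIdealPow_then_singularPoints` (p839495):
`X₁ = Bl_{(𝔔'Ê)ᵃ⁺¹}(Spec Ê)`; if `Sing X₁` is FINITE and `Bl_{𝔪_z}(Spec 𝒪_{X₁,z})` is regular for each singular `z`, then `hloc`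
holds at the twisted point (`hZc`, `hpt` AND `hZ𝔪` of p839495 discharged). [cite: StacksProject, Tag 080B; Tag 0CDQ; Tag 09EB; Tag 02J8]
[cite: Matsumura1987, Thm. 8.11; Thm. 8.14] -/
theorem hloc_of_maximalIdealPow_then_finite_singularPoints (K : Type) [Field K] (X : Scheme.{0}) [IsIntegral X]
    (f : X ⟶ Spec (.of K)) [LocallyOfFiniteType f]
    {B : Type} [CommRing B] [IsDomain B] [Algebra K B] [Algebra.FiniteType K B]
    (ι : Spec (.of B) ⟶ X) [IsOpenImmersion ι] (hι : ι ≫ f = Spec.map (CommRingCat.ofHom (algebraMap K B)))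
    (𝔭 : Ideal B) [h𝔭 : 𝔭.IsMaximal] (h𝔭0 : 𝔭 ≠ ⊥)
    (hsing : ι ⟨𝔭, h𝔭.isPrime⟩ ∉ Scheme.regularLocus X)
    (hregB : ∀ P : Spec (.of B), P.asIdeal ≠ 𝔭 → P ∈ Scheme.regularLocus (Spec (.of B)))
    (K' : Type) [Field K'] [Algebra K K'] [FiniteDimensional K K'] [IsGalois K K']
    (𝔔' : Ideal (B ⊗[K] K')) [h𝔔' : 𝔔'.IsMaximal] (h𝔔'𝔭 : 𝔔'.comap (algebraMap B (B ⊗[K] K')) = 𝔭) (a : ℕ)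
    (hfin : (Scheme.regularLocus (affineBlowup ((𝔔'.map (algebraMap (B ⊗[K] K')
      (AdicCompletion (maximalIdeal (Localization.AtPrime 𝔔')) (Localization.AtPrime 𝔔')))) ^ (a + 1))))ᶜ.Finite)
    (hloc : ∀ z ∈ (Scheme.regularLocus (affineBlowup ((𝔔'.map (algebraMap (B ⊗[K] K')
      (AdicCompletion (maximalIdeal (Localization.AtPrime 𝔔')) (Localization.AtPrime 𝔔')))) ^ (a + 1))))ᶜ,
      Scheme.IsRegular (affineBlowup (maximalIdeal ((affineBlowup ((𝔔'.map (algebraMap (B ⊗[K] K')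
        (AdicCompletion (maximalIdeal (Localization.AtPrime 𝔔')) (Localization.AtPrime 𝔔')))) ^ (a + 1))).presheaf.stalk z)))) :
    ∃ (V : X.Opens), ι ⟨𝔭, h𝔭.isPrime⟩ ∈ V ∧
      (∀ t : X, t ∉ Scheme.regularLocus X → t ∈ V → t = ι ⟨𝔭, h𝔭.isPrime⟩) ∧
      ∃ (Y : Scheme.{0}) (ρ : Y ⟶ V), IsProper ρ ∧ Scheme.IsRegular Y ∧
        IsIso (ρ ∣_ (V.ι ⁻¹ᵁ ⟨Scheme.regularLocus X, isOpen_regularLocus_of_locallyOfFiniteType_field f⟩)) ∧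
        Dense ((ρ ⁻¹ᵁ (V.ι ⁻¹ᵁ ⟨Scheme.regularLocus X,
          isOpen_regularLocus_of_locallyOfFiniteType_field f⟩) : Y.Opens) : Set Y) := by
  haveI : IsNoetherianRing B := Algebra.FiniteType.isNoetherianRing K B
  haveI : Algebra.FiniteType B (B ⊗[K] K') := inferInstance
  haveI : IsNoetherianRing (B ⊗[K] K') := Algebra.FiniteType.isNoetherianRing B (B ⊗[K] K')
  haveI : IsNoetherianRing (Localization.AtPrime 𝔔') :=
    IsLocalization.isNoetherianRing 𝔔'.primeCompl (Localization.AtPrime 𝔔') inferInstance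
  set Ê := AdicCompletion (maximalIdeal (Localization.AtPrime 𝔔')) (Localization.AtPrime 𝔔') with hÊ
  haveI : IsNoetherianRing Ê := isNoetherianRing_adicCompletion_maximalIdeal _
  have hfac : algebraMap (B ⊗[K] K') Ê =
      (algebraMap (Localization.AtPrime 𝔔') Ê).comp (algebraMap (B ⊗[K] K') (Localization.AtPrime 𝔔')) :=
    RingHom.ext fun _ => rfl
  have hmapQ : 𝔔'.map (algebraMap (B ⊗[K] K') Ê) = maximalIdeal Ê := by
    rw [hfac, ← Ideal.map_map, Localization.AtPrime.map_eq_maximalIdeal, ← AdicCompletion.maximalIdeal_eq_map]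
  set 𝔪 := 𝔔'.map (algebraMap (B ⊗[K] K') Ê) with h𝔪
  haveI h𝔪max : 𝔪.IsMaximal := by
    rw [hmapQ]
    infer_instance
  have hn : 𝔪 ^ (a + 1) ≤ 𝔪 ^ (a + 1) := le_rfl
  have hJ₁𝔪 : 𝔪 ^ (a + 1) ≤ 𝔪 := Ideal.pow_le_self (Nat.succ_ne_zero a)
  have hZ𝔪 : ∀ z ∈ (Scheme.regularLocus (affineBlowup (𝔪 ^ (a + 1))))ᶜ, 𝔪 ≤ (affineBlowup.π (𝔪 ^ (a + 1)) z).asIdeal :=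
    SingularPointsOverVertex.hZ𝔪_of_galois K 𝔭 hregB K' 𝔔' (𝔪 ^ (a + 1)) hn hJ₁𝔪
  obtain ⟨hZc, hpt⟩ := isClosed_and_isClosed_singleton_of_finite 𝔪 (𝔪 ^ (a + 1)) hfin hZ𝔪
  exact MaximalIdealTower.hloc_of_maximalIdealPow_then_singularPoints K X f ι hι 𝔭 h𝔭0 hsing hregB K' 𝔔' h𝔔'𝔭 a hZc hpt
    hZ𝔪 hloc

/-- ★★★ **SCHEME SIDE, FINITE FORM.** As `…IntrinsicRecipeGlobal.hasResolution_of_characteristic_then_singularPoints` (p839830) with,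
at each of the finitely many singular points, «`Sing Bl_{J₁}(Spec Ê)` closed, of closed points» replaced by «`Sing Bl_{J₁}(Spec Ê)` finite».
[cite: StacksProject, Tag 080B; Tag 0CDQ; Tag 09EB; Tag 02J8] [cite: Kollar2007, §2.2] [cite: Matsumura1987, Thm. 8.11; Thm. 8.14] -/
theorem hasResolution_of_characteristic_then_finite_singularPoints (K : Type) [Field K] (X : Scheme.{0}) [IsIntegral X]
    (f : X ⟶ Spec (.of K)) [LocallyOfFiniteType f] (hfin : (Scheme.regularLocus X)ᶜ.Finite)
    (hchart : ∀ s : X, s ∉ Scheme.regularLocus X →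
      ∃ (B : Type) (_ : CommRing B) (_ : IsDomain B) (_ : Algebra K B) (_ : Algebra.FiniteType K B)
        (ι : Spec (.of B) ⟶ X) (_ : IsOpenImmersion ι)
        (_ : ι ≫ f = Spec.map (CommRingCat.ofHom (algebraMap K B)))
        (𝔭 : Ideal B) (h𝔭 : 𝔭.IsMaximal) (_ : 𝔭 ≠ ⊥) (_ : ι ⟨𝔭, h𝔭.isPrime⟩ = s)
        (_ : ∀ P : Spec (.of B), P.asIdeal ≠ 𝔭 → P ∈ Scheme.regularLocus (Spec (.of B)))
        (K' : Type) (_ : Field K') (_ : Algebra K K') (_ : FiniteDimensional K K') (_ : IsGalois K K')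
        (𝔔' : Ideal (B ⊗[K] K')) (_ : 𝔔'.IsMaximal)
        (J₁ : Ideal (AdicCompletion (maximalIdeal (Localization.AtPrime 𝔔')) (Localization.AtPrime 𝔔')))
        (n : ℕ) (_ : (Scheme.regularLocus (affineBlowup J₁))ᶜ.Finite),
          𝔔'.comap (algebraMap B (B ⊗[K] K')) = 𝔭 ∧
          𝔔'.map (algebraMap (B ⊗[K] K')
            (AdicCompletion (maximalIdeal (Localization.AtPrime 𝔔')) (Localization.AtPrime 𝔔'))) ^ n ≤ J₁ ∧
          J₁ ≠ ⊤ ∧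
          (∀ θ : AdicCompletion (maximalIdeal (Localization.AtPrime 𝔔')) (Localization.AtPrime 𝔔') ≃+*
              AdicCompletion (maximalIdeal (Localization.AtPrime 𝔔')) (Localization.AtPrime 𝔔'), J₁.map (θ : _ →+* _) ≤ J₁) ∧
          (∀ z ∈ (Scheme.regularLocus (affineBlowup J₁))ᶜ,
            Scheme.IsRegular (affineBlowup (maximalIdeal ((affineBlowup J₁).presheaf.stalk z))))) :
    Scheme.HasResolution X := by
  refine IsolatedGlue.hasResolution_of_finite_singularLocus_of_local K X f hfin fun s hs => ?_
  obtain ⟨B, _, _, _, _, ι, _, hι, 𝔭, h𝔭, h𝔭0, hιs, hregB, K', _, _, _, _, 𝔔', _, J₁, n, hfin₁, h𝔔'𝔭, hn, hJ₁top, hchar, hloc⟩ :=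
    hchart s hs
  subst hιs
  exact hloc_of_characteristic_then_finite_singularPoints K X f ι hι 𝔭 h𝔭0 hs hregB K' 𝔔' h𝔔'𝔭 J₁ hn hJ₁top hchar hfin₁ hloc

end Summit.ResolutionOfSingularities.ResolutionOfSingularities.Theorems.FRationalResolution.SingularPointsFinite

end
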